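import Summits.BirchSwinnertonDyer.BirchSwinnertonDyer.Theses.BiquadraticEisensteinDescent
import Summits.BirchSwinnertonDyer.BirchSwinnertonDyer.Theorems.BiquadraticEisensteinDescentHeegnerTwistCouplingInSupplyDensityOneSwitch
import HarnessLib

set_option linter.dupNamespace false -- `Summit.BirchSwinnertonDyer.BirchSwinnertonDyer.Theorems.…` (summit = sub, D-0017)
set_option autoImplicit false

/-!
# The K′-supply crux KS_R (`HeegnerFieldSupplyCMInertBadKPrime`, stmt-BirchSwinnertonDyer-20713, BED rank 5) BY NAME
# from the density-one print inputs and the W-free class-group statement C⁺ — the PARENT-LEVEL glue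

Route `BiquadraticEisensteinDescent` (cell `pub/bsd-wall`, row 12), line lead `bsd-line-ibd-p1` g3, 2026-08-28.
THEOREMS ONLY (no definition, no named fact, no `sorry`). BSD is not proved by any of this; nothing here claims C⁺.

Context. KS_R (stmt-20713) is SPLIT at gen 1 (rev 24) into the print input `BeckwithRaumRichterResidueInput`
(stmt-21379, held), the class-number supply `HeegnerClassNumberSupplyCMInertBadOfBRR` (stmt-21380, proved) and the
COUPLING `HeegnerTwistCouplingInSupply` (stmt-21381, open), glued by stmt-21382 (proved). The density-one switch
(`…HeegnerTwistCouplingInSupplyDensityOneSwitch`, p610230, lead g2 after crux idea card `goldfeld-density-one-switch`)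
showed that the coupling child follows from four printed inputs — the Modularity Theorem `exists_isNewformOf`, the
Burungale–Tian rank-zero `2`-converse for CM curves, Monsky's `2`-parity, Smith's `2^∞`-Selmer corank law for CM
curves — and ONE W-free, `L`-free statement C⁺ («for every level `N ≠ 0` and prime `p ≥ 5` the discriminants of
imaginary quadratic Heegner fields of level `N` with `|d| > 4` and `p ∤ h` are not a `twistDensity`-null set»), and
that its proof never uses the `∀B` class-number supply hypothesis of the coupling child. Consequently the supply
child and the BRR input are idle on this road, and the PARENT KS_R itself follows from the same inputs. Since items
live on at most two layers (CONVENTIONS §5), stmt-21381 (a gen-1 child) cannot be split again; the executable planner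
move is a RE-SPLIT OF THE PARENT stmt-20713 into two children — a held print-input child whose body is the
conjunction `DensityOnePrintInputs` below and a crux child whose body is C⁺ verbatim (= the registered stub
`stub_nonNullIndivisibleHeegner` of skeleton size_tail v4 `91e83c17…`) — glued by
`heegnerFieldSupplyCMInertBadKPrime_of_densityOneParts` (shape `Inputs → C⁺ → KS_R`, KS_R by name, the two
antecedents by value). This file supplies exactly that glue, kernel-checked, plus the unfolded-Smith variant.

Contents: `heegnerFieldSupplyCMInertBadKPrime_of_nonNull` (facts by name + C⁺ ⇒ KS_R by name);
`heegnerFieldSupplyCMInertBadKPrime_of_densityOneParts` (the 2-child glue shape: conjunction of the four inputs →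
C⁺ → KS_R); `heegnerFieldSupplyCMInertBadKPrime_of_printedInputs_of_nonNull` (Smith's law unfolded into
`smith2022_selmerCorank_distribution` + arXiv:2503.17619 Thm 1.17 Cases IV/V via `smith_selmerCorank_density_holds_of`).
CONDITIONAL (gate class conditional-result) on the named facts and on C⁺, which is OPEN for every `p ≥ 5`
(Kohnen–Ono 1999 Thm 1: `≫ √X/log X`; Beckwith–Raum–Richter IMRN 2024 Thm 1: existence with splitting conditions;
positive proportion in print only at `ℓ = 3`).

References: [arXiv250317619] A. Smith, arXiv:2503.17619, Thm. 1.1, Thm. 1.17; [Smith2022SelmerTwistI] J. Amer. Math.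
Soc. 39 (2026); [BurungaleTian2026] Ann. of Math. (2) 203 (2026), Thm. 1.1; [DokchitserDokchitserAnnals2010] §4.6
(Monsky 1996); [BCDTJAMS2001] Thm. A; [KohnenOno1999] Invent. Math. 135, Thm. 1; [BeckwithRaumRichter2024] IMRN 2024, Thm. 1.
-/

noncomputable section

open scoped Classical

open WeierstrassCurve Literature.NumberTheory.EllipticCurves
  Literature.NumberTheory.EllipticCurves.Rank1Residual

namespace Summit.BirchSwinnertonDyer.BirchSwinnertonDyer.Theorems.BiquadraticEisensteinDescentHeegnerFieldSupplyCMInertBadKPrimeOfDensityOne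

open Summit.BirchSwinnertonDyer.BirchSwinnertonDyer.Theses.BiquadraticEisensteinDescent
open Summit.BirchSwinnertonDyer.BirchSwinnertonDyer.Theorems.BiquadraticEisensteinDescentHeegnerTwistCouplingInSupplyDensityOneSwitch

/-- **KS_R by name from the density-one inputs and C⁺.** Grant the Modularity Theorem (`exists_isNewformOf`),
the Burungale–Tian rank-zero `p`-converse for CM curves over `ℚ` (Ann. of Math. 203 (2026) Thm. 1.1, used at the
prime `2`), Monsky's `2`-parity (Dokchitser–Dokchitser 2010 §4.6) and Smith's `2^∞`-Selmer corank law for every CM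
curve over `ℚ` (arXiv:2503.17619 Thm. 1.1). If for every level `N ≠ 0` and every prime `p ≥ 5` the `p`-indivisible
Heegner discriminants of level `N` with `|d| > 4` are not a `twistDensity`-null set (C⁺, OPEN), then the K′-supply
crux `HeegnerFieldSupplyCMInertBadKPrime` (stmt-BirchSwinnertonDyer-20713) holds: for every `(W, p)` in the CM
inert-bad corner of analytic rank `1` with `p ≥ 5` some imaginary quadratic Heegner field `K′` of `N_W` with
`|d_K′| > 4` has `L(W^{(d_K′)},1) ≠ 0` and `p ∤ h(K′)`. Proof: the one-curve density-one switch
`exists_heegnerField_twist_L_one_ne_zero_of_nonNull` at `(W, p)` with C⁺ at level `N_W`; the corner hypotheses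
`CMInert`, `¬ Good` are not used. [cite: arXiv250317619, Thm. 1.1] [cite: BurungaleTian2026, Thm. 1.1]
[cite: DokchitserDokchitserAnnals2010, §4.6] [cite: BCDTJAMS2001, Thm. A] -/
theorem heegnerFieldSupplyCMInertBadKPrime_of_nonNull
    (hmod : ModularForms.exists_isNewformOf)
    (hBT : burungaleTian_analyticRank_eq_zero_of_selmerCorank_eq_zero_of_hasCM)
    (hMon : monsky_selmerCorank_two_mod_two_eq)
    (hS : ∀ (W : WeierstrassCurve ℚ) [W.IsElliptic], W.HasCM → smith_selmerCorank_density W)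
    (hC : ∀ (N p : ℕ), N ≠ 0 → p.Prime → 5 ≤ p →
      ¬ twistDensity (fun d : ℤ ↦ ∃ (K : Type) (_ : Field K) (_ : NumberField K),
        IsImaginaryQuadratic K ∧ NumberField.discr K = d ∧ 4 < d.natAbs ∧
        SatisfiesHeegnerHypothesis N K ∧ ¬ p ∣ NumberField.classNumber K) 0) :
    HeegnerFieldSupplyCMInertBadKPrime := by
  intro W _ _ p hp hN hCM hr hp5 _ _
  exact exists_heegnerField_twist_L_one_ne_zero_of_nonNull hmod hBT hMon W p hCM hr (hS W hCM)
    (hC _ p hN.out hp.out hp5)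

/-- **The 2-child glue shape for a gen-1 re-split of KS_R (stmt-20713).** With the held print-input child typed as
the conjunction `exists_isNewformOf ∧ burungaleTian_analyticRank_eq_zero_of_selmerCorank_eq_zero_of_hasCM ∧
monsky_selmerCorank_two_mod_two_eq ∧ (∀ CM W, smith_selmerCorank_density W)` (= the registered stub
`stub_printedInputsDensityOne` of skeleton size_tail v4) and the crux child typed as C⁺ verbatim (= the registered
stub `stub_nonNullIndivisibleHeegner`), this theorem IS the glue `Inputs → C⁺ → HeegnerFieldSupplyCMInertBadKPrime`
(KS_R by name; antecedents by value). [cite: arXiv250317619, Thm. 1.1] [cite: BurungaleTian2026, Thm. 1.1]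
[cite: DokchitserDokchitserAnnals2010, §4.6] [cite: BCDTJAMS2001, Thm. A] -/
theorem heegnerFieldSupplyCMInertBadKPrime_of_densityOneParts
    (hIn : ModularForms.exists_isNewformOf ∧
      burungaleTian_analyticRank_eq_zero_of_selmerCorank_eq_zero_of_hasCM ∧
      monsky_selmerCorank_two_mod_two_eq ∧
      (∀ (W : WeierstrassCurve ℚ) [W.IsElliptic], W.HasCM → smith_selmerCorank_density W))
    (hC : ∀ (N p : ℕ), N ≠ 0 → p.Prime → 5 ≤ p →
      ¬ twistDensity (fun d : ℤ ↦ ∃ (K : Type) (_ : Field K) (_ : NumberField K),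
        IsImaginaryQuadratic K ∧ NumberField.discr K = d ∧ 4 < d.natAbs ∧
        SatisfiesHeegnerHypothesis N K ∧ ¬ p ∣ NumberField.classNumber K) 0) :
    HeegnerFieldSupplyCMInertBadKPrime :=
  heegnerFieldSupplyCMInertBadKPrime_of_nonNull hIn.1 hIn.2.1 hIn.2.2.1 hIn.2.2.2 hC

/-- **KS_R by name with Smith's law unfolded into the tree's printed inputs** (`smith_selmerCorank_density_holds_of`:
the Modularity Theorem, Monsky's `2`-parity, Smith's refereed 2022 distribution theorem
`smith2022_selmerCorank_distribution` (J. Amer. Math. Soc. 39 (2026)) and arXiv:2503.17619 Thm. 1.17 in Cases IV and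
V), the Burungale–Tian `2`-converse, and C⁺. [cite: arXiv250317619, Thm. 1.1, Thm. 1.17]
[cite: Smith2022SelmerTwistI, Thm. 1.2] [cite: BurungaleTian2026, Thm. 1.1] [cite: DokchitserDokchitserAnnals2010, §4.6]
[cite: BCDTJAMS2001, Thm. A] -/
theorem heegnerFieldSupplyCMInertBadKPrime_of_printedInputs_of_nonNull
    (hmod : ModularForms.exists_isNewformOf)
    (hBT : burungaleTian_analyticRank_eq_zero_of_selmerCorank_eq_zero_of_hasCM)
    (hMon : monsky_selmerCorank_two_mod_two_eq)
    (h22 : smith2022_selmerCorank_distribution) (h17IV : smith2025_thm117_caseIV)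
    (h17V : smith2025_thm117_caseV)
    (hC : ∀ (N p : ℕ), N ≠ 0 → p.Prime → 5 ≤ p →
      ¬ twistDensity (fun d : ℤ ↦ ∃ (K : Type) (_ : Field K) (_ : NumberField K),
        IsImaginaryQuadratic K ∧ NumberField.discr K = d ∧ 4 < d.natAbs ∧
        SatisfiesHeegnerHypothesis N K ∧ ¬ p ∣ NumberField.classNumber K) 0) :
    HeegnerFieldSupplyCMInertBadKPrime :=
  heegnerFieldSupplyCMInertBadKPrime_of_nonNull hmod hBT hMon
    (fun W _ _ ↦ smith_selmerCorank_density_holds_of hmod hMon h22 h17IV h17V W) hC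

end Summit.BirchSwinnertonDyer.BirchSwinnertonDyer.Theorems.BiquadraticEisensteinDescentHeegnerFieldSupplyCMInertBadKPrimeOfDensityOne

end
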